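import Summits.QuantumAdvantage.AdviceFreeQNC0.AffBells29Transfer
import Summits.QuantumAdvantage.AdviceFreeQNC0.AffBells28Anf
import HarnessLib

/-!
# AffBells33 — FIBRE TARGETS of the SPUL line for (NP₁): `FibreDichotomy`, `ExFib`, `WideNonExact`, and the PROVED glue (Part III of `FibreDichotomyProof33.lean`)

Cell qa-qnc0, route DWalkThree (crux stmt-QuantumAdvantage-22907; rung (NP₁) `AffBells26.AffBellsPolyLoss3`).  AUTHORED AND PROVED BY THE
PLANNER SEAT qa-qnc0-p1 g33 (`HOME/qa-qnc0-p1/exp33/FibreDichotomyProof33.lean` Part III = `FibreDichotomy33.lean`, farm rc 0 / 0 sorry;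
memo ROUND-32 §3/§6); landed VERBATIM by qn-prover-3 g19, ask P-33a(3) (consumers: P-35h `NonExactToLoss`, P-38a `PolyLossOfIFM`).
The planner's module docstring follows.
-/

/-!
# FibreDichotomy33 (planner qa-qnc0-p1 g33, ROUND-32 §3/§6): the SPUL line for the rung (NP₁) = `AffBells26.AffBellsPolyLoss3` — typed targets + PROVED glue

The odd class is fibred by the kernel line `J = kline x` (`Fib19`): the fibre `F_J` (coins `C` = zeros of `J`, `|C| = Z`) is a parity class
`H_p ⊂ {0,1}^C` of size `2^{Z-1}` (`Fib19.card_fibre`), on which the forced bits and the active set `{b : J_b = 1}` are constant.  On `F_J` the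
loss indicator of an affine MOD₃ bell strategy `(β, c)` times `1_{H_p}` is a combination of `≤ (N+2)²/2` product functions `Q_w`, `w ∈ (𝔽₄ˣ)^C`
(fibre dictionary, ROUND-32 §2), so the SPARSE PRODUCT-FUNCTION UNCERTAINTY LEMMA (`exp33/Spul33.lean`, PROVED: an `s`-sparse combination of
`𝔽₄ˣ`-valued product functions that is not identically zero on `{0,1}^n` is non-zero on `≥ 2^{n - ⌈log_{3/2} s⌉}` points) gives the

**FIBRE DICHOTOMY** (`FibreDichotomy`, target; `e = 4` works for all `N ≥ 1`): every kline-fibre is EXACT-WIN (`F_J ⊆ WIN(β,c)`) or contains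
`≥ |F_J| / (N+1)^e` losers — with NO width / drop / obliviousness hypothesis.

Consequently (PROVED here, `polyLoss_of_exFib`): (NP₁) ⟸ `FibreDichotomy ∧ ExFib`, where `ExFib` = «the non-exact fibres carry `≥ 2^{N-1}/N^e` odd
inputs»; and (PROVED here, `exFib_of_wide`, `polyLoss_of_wide`) `ExFib` — indeed (NP₁) — follows from `FibreDichotomy` and the single WIDE-ROW
crux `WideNonExact` («some row of weight `≥ K·log₂ N` ⇒ non-exact mass `≥ 2^{N-1}/N^e`»), because an ALL-NARROW strategy is a `K log₂ N`-junta
strategy and loses a constant fraction by the tree theorem `AffBells29.juntaLogHard` (`narrow_loses`, PROVED here).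

WHY `WideNonExact` should hold (ROUND-32 §4/§6): the ISOLATION LEMMA (`exp33/Isolation33.lean`, PROVED on the cube; parity-class version pencil):
in an exact-win fibre every restricted row pattern with non-zero NET coefficient lies within Hamming distance `log₂(2N)+O(log log N)` (on the coins)
of another active row's pattern or of its negative, or reads that few coins; a wide row violates this unless it belongs to a near-twin cluster whose
net coefficient vanishes on the fibre, and net coefficients of clusters are toggled by the hard-core coin process with constant conditional probability.

WHAT THIS IS NOT: no claim about the crux `RingDenseResidualLt3`; `FibreDichotomy` is a consequence of two PROVED lemmas + the fibre dictionary
(assembly = prover task P-33b), `WideNonExact` is a CONJECTURE (typed, unproved); separation NOT moved.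
-/

noncomputable section

open Classical

namespace Summit.QuantumAdvantage.AdviceFreeQNC0

namespace AffBells33

open Finset Literature.Computability.QuantumComplexity Literature.Computability.QuantumComplexity.RingHLF
open AffBells23 AffBells26 Fib19 AffBells29

variable {N : ℕ}

/-- The kline-fibre of `x` inside the odd class. -/
def fibre (x : Fin N → Bool) : Finset (Fin N → Bool) := univ.filter fun x' => IsOdd x' ∧ kline x' = kline x

/-- The losers of `(β, c)` inside the fibre of `x`. -/
def fibreLosers (β : Fin N → Fin N → ZMod 3) (c : Fin N → ZMod 3) (x : Fin N → Bool) : Finset (Fin N → Bool) :=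
  univ.filter fun x' => IsOdd x' ∧ kline x' = kline x ∧ ¬ Rel x' (affBell β c x')

/-- EXACT-WIN fibre: `(β, c)` wins on every odd input with the kernel line of `x`. -/
def ExactFibre (β : Fin N → Fin N → ZMod 3) (c : Fin N → ZMod 3) (x : Fin N → Bool) : Prop :=
  ∀ x' : Fin N → Bool, IsOdd x' → kline x' = kline x → Rel x' (affBell β c x')

/-- The odd inputs lying in NON-exact fibres. -/
def nonExact (β : Fin N → Fin N → ZMod 3) (c : Fin N → ZMod 3) : Finset (Fin N → Bool) :=
  univ.filter fun x => IsOdd x ∧ ¬ ExactFibre β c x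

/-- **FIBRE DICHOTOMY (target; = SPUL + fibre dictionary, `e = 4` works):** every kline-fibre is exact-win or has at least `|F|/(N+1)^e` losers. -/
def FibreDichotomy : Prop :=
  ∃ e : ℕ, ∀ N : ℕ, 3 ≤ N → ∀ (β : Fin N → Fin N → ZMod 3) (c : Fin N → ZMod 3) (x : Fin N → Bool), IsOdd x →
    ExactFibre β c x ∨ (fibre x).card ≤ (N + 1) ^ e * (fibreLosers β c x).card

/-- **EXFIB (target):** the non-exact fibres carry at least a `N^{-e}` fraction of the odd class. -/
def ExFib : Prop :=
  ∃ e n₀ : ℕ, ∀ N ≥ n₀, ∀ (β : Fin N → Fin N → ZMod 3) (c : Fin N → ZMod 3), 2 ^ (N - 1) ≤ N ^ e * (nonExact β c).card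

/-- **THE WIDE-ROW CRUX (W) (CONJECTURE):** if some row has weight `≥ K·log₂ N`, the non-exact fibres carry `≥ 2^{N-1}/N^e` odd inputs. -/
def WideNonExact : Prop :=
  ∃ K e n₀ : ℕ, ∀ N ≥ n₀, ∀ (β : Fin N → Fin N → ZMod 3) (c : Fin N → ZMod 3),
    (∃ b, K * Nat.log 2 N ≤ (rowSupp β b).card) → 2 ^ (N - 1) ≤ N ^ e * (nonExact β c).card

/-! ### PROVED glue -/

/-- **NARROW HALF (PROVED, = `juntaLogHard`):** one absolute `θ < 1`; all rows of weight `≤ K log₂ N` ⇒ `affWinCard ≤ θ·2^{N−1}` (`N ≥ n₀(K)`). -/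
theorem narrow_loses : ∃ θ : ℝ, θ < 1 ∧ ∀ K : ℕ, ∃ n₀ : ℕ, ∀ N ≥ n₀, ∀ (β : Fin N → Fin N → ZMod 3) (c : Fin N → ZMod 3),
    (∀ b, (rowSupp β b).card ≤ K * Nat.log 2 N) → (affWinCard β c : ℝ) ≤ θ * (2 : ℝ) ^ (N - 1) := by
  obtain ⟨θ, hθ, hall⟩ := juntaLogHard
  refine ⟨θ, hθ, fun K => ?_⟩
  obtain ⟨n₀, hn₀⟩ := hall K
  refine ⟨n₀, fun N hN β c hw => ?_⟩
  rw [affWinCard_eq_winCount]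
  exact hn₀ N hN (rowSupp β) (fun k x => affBell β c x k) hw (fun k => readsOnly_affBell β c k)

/-- Losers lie in non-exact fibres. -/
theorem losers_subset_nonExact (β : Fin N → Fin N → ZMod 3) (c : Fin N → ZMod 3) : losers β c ⊆ nonExact β c := by
  intro x hx
  simp only [losers, nonExact, mem_filter, mem_univ, true_and] at hx ⊢
  exact ⟨hx.1, fun h => hx.2 (h x hx.1 rfl)⟩

/-- The double count: under the fibre dichotomy, non-exact mass `≤ (N+1)^e ·` losers. -/
theorem nonExact_le_losers (hD : FibreDichotomy) : ∃ e : ℕ, ∀ N : ℕ, 3 ≤ N → ∀ (β : Fin N → Fin N → ZMod 3) (c : Fin N → ZMod 3),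
    (nonExact β c).card ≤ (N + 1) ^ e * (losers β c).card := by
  obtain ⟨e, he⟩ := hD
  refine ⟨e, fun N hN β c => ?_⟩
  have h1 : (nonExact β c).card = ∑ v : Fin N → Bool, ((nonExact β c).filter fun x => kline x = v).card :=
    card_eq_sum_card_fiberwise (fun x _ => mem_univ (kline x))
  have h2 : (losers β c).card = ∑ v : Fin N → Bool, ((losers β c).filter fun x => kline x = v).card :=
    card_eq_sum_card_fiberwise (fun x _ => mem_univ (kline x))
  rw [h1, h2, mul_sum]
  refine sum_le_sum fun v _ => ?_
  by_cases hempty : ((nonExact β c).filter fun x => kline x = v) = ∅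
  · rw [hempty, card_empty]; exact Nat.zero_le _
  · obtain ⟨x₀, hx₀⟩ := nonempty_iff_ne_empty.2 hempty
    simp only [nonExact, mem_filter, mem_univ, true_and] at hx₀
    obtain ⟨⟨hodd, hne⟩, hk⟩ := hx₀
    rcases he N hN β c x₀ hodd with hex | hle
    · exact absurd hex hne
    · have hsub : ((nonExact β c).filter fun x => kline x = v) ⊆ fibre x₀ := by
        intro x hx
        simp only [nonExact, fibre, mem_filter, mem_univ, true_and] at hx ⊢
        exact ⟨hx.1.1, hx.2.trans hk.symm⟩
      have hsub' : fibreLosers β c x₀ ⊆ (losers β c).filter fun x => kline x = v := by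
        intro x hx
        simp only [fibreLosers, losers, mem_filter, mem_univ, true_and] at hx ⊢
        exact ⟨⟨hx.1, hx.2.2⟩, hx.2.1.trans hk⟩
      calc ((nonExact β c).filter fun x => kline x = v).card ≤ (fibre x₀).card := card_le_card hsub
        _ ≤ (N + 1) ^ e * (fibreLosers β c x₀).card := hle
        _ ≤ (N + 1) ^ e * ((losers β c).filter fun x => kline x = v).card := Nat.mul_le_mul_left _ (card_le_card hsub')

/-- From a polynomial lower bound on the losers to the (NP₁) shape. -/
theorem polyLoss_of_losers_bound (E n₀ : ℕ) (h : ∀ N ≥ n₀, 3 ≤ N → ∀ (β : Fin N → Fin N → ZMod 3) (c : Fin N → ZMod 3),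
    2 ^ (N - 1) ≤ N ^ E * (losers β c).card) : AffBellsPolyLoss3 := by
  refine ⟨E, max n₀ 3, fun N hN β c => ?_⟩
  have hN₀ : n₀ ≤ N := le_trans (le_max_left _ _) hN
  have h3 : 3 ≤ N := le_trans (le_max_right _ _) hN
  have hNpos : (0 : ℝ) < N := by exact_mod_cast (show 0 < N by omega)
  have hNE : (0 : ℝ) < (N : ℝ) ^ E := by positivity
  have hsum : (affWinCard β c : ℝ) + (losers β c).card = (2 : ℝ) ^ (N - 1) := by
    exact_mod_cast affWinCard_add_losers (by omega) β c
  have hlos : (2 : ℝ) ^ (N - 1) ≤ (N : ℝ) ^ E * (losers β c).card := by exact_mod_cast h N hN₀ h3 β c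
  have hlos' : (2 : ℝ) ^ (N - 1) / (N : ℝ) ^ E ≤ (losers β c).card := by
    rw [div_le_iff₀' hNE]; exact hlos
  have hdiv : (1 - 1 / (N : ℝ) ^ E) * (2 : ℝ) ^ (N - 1) = (2 : ℝ) ^ (N - 1) - (2 : ℝ) ^ (N - 1) / (N : ℝ) ^ E := by ring
  rw [hdiv]
  linarith

/-- **(NP₁) ⟸ FIBRE DICHOTOMY + EXFIB (PROVED glue).** -/
theorem polyLoss_of_exFib (hD : FibreDichotomy) (hE : ExFib) : AffBellsPolyLoss3 := by
  obtain ⟨e, he⟩ := nonExact_le_losers hD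
  obtain ⟨e₂, n₀, hE⟩ := hE
  refine polyLoss_of_losers_bound (e₂ + 2 * e) n₀ fun N hN h3 β c => ?_
  have h1 := hE N hN β c
  have h2 := he N h3 β c
  have hN1 : N + 1 ≤ N ^ 2 := by nlinarith
  have h3' : (N + 1) ^ e ≤ (N ^ 2) ^ e := Nat.pow_le_pow_left hN1 e
  calc 2 ^ (N - 1) ≤ N ^ e₂ * (nonExact β c).card := h1
    _ ≤ N ^ e₂ * ((N + 1) ^ e * (losers β c).card) := Nat.mul_le_mul_left _ h2
    _ ≤ N ^ e₂ * ((N ^ 2) ^ e * (losers β c).card) := Nat.mul_le_mul_left _ (Nat.mul_le_mul_right _ h3')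
    _ = N ^ (e₂ + 2 * e) * (losers β c).card := by rw [← pow_mul, pow_add, mul_assoc]

/-- **EXFIB ⟸ (W) (PROVED glue via the narrow half):** all-narrow strategies lose a constant fraction (so their losers — which lie in non-exact
fibres — already have mass `≥ (1−θ)2^{N−1} ≥ 2^{N−1}/N`), wide ones are covered by `WideNonExact`. -/
theorem exFib_of_wide (hW : WideNonExact) : ExFib := by
  obtain ⟨K, e, n₀, hW⟩ := hW
  obtain ⟨θ, hθ, hall⟩ := narrow_loses
  obtain ⟨n₁, hn₁⟩ := hall K
  obtain ⟨M, hM⟩ := exists_nat_gt (1 / (1 - θ))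
  refine ⟨e + 1, max (max n₀ n₁) (max M 3), fun N hN β c => ?_⟩
  have hN₀ : n₀ ≤ N := le_trans (le_trans (le_max_left _ _) (le_max_left _ _)) hN
  have hN₁ : n₁ ≤ N := le_trans (le_trans (le_max_right _ _) (le_max_left _ _)) hN
  have hNM : M ≤ N := le_trans (le_trans (le_max_left _ _) (le_max_right _ _)) hN
  have h3 : 3 ≤ N := le_trans (le_trans (le_max_right _ _) (le_max_right _ _)) hN
  by_cases hwide : ∃ b, K * Nat.log 2 N ≤ (rowSupp β b).card
  · calc 2 ^ (N - 1) ≤ N ^ e * (nonExact β c).card := hW N hN₀ β c hwide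
      _ ≤ N ^ (e + 1) * (nonExact β c).card :=
        Nat.mul_le_mul_right _ (Nat.pow_le_pow_right (by omega) (by omega))
  · push Not at hwide
    have hwin := hn₁ N hN₁ β c fun b => (hwide b).le
    have hsum : (affWinCard β c : ℝ) + (losers β c).card = (2 : ℝ) ^ (N - 1) := by
      exact_mod_cast affWinCard_add_losers (by omega) β c
    have hNpos : (0 : ℝ) < N := by exact_mod_cast (show 0 < N by omega)
    have h1t : 0 < 1 - θ := by linarith
    have hNt : 1 / (1 - θ) < (N : ℝ) := lt_of_lt_of_le hM (by exact_mod_cast hNM)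
    have hNθ : 1 ≤ (N : ℝ) * (1 - θ) := by
      have := (div_lt_iff₀ h1t).1 hNt
      linarith
    have h2pow : (0 : ℝ) < (2 : ℝ) ^ (N - 1) := by positivity
    -- losers ≥ (1-θ) 2^{N-1} ≥ 2^{N-1}/N
    have hlosR : (2 : ℝ) ^ (N - 1) ≤ (N : ℝ) * (losers β c).card := by
      have hl : (1 - θ) * (2 : ℝ) ^ (N - 1) ≤ (losers β c).card := by nlinarith
      calc (2 : ℝ) ^ (N - 1) ≤ (N : ℝ) * (1 - θ) * (2 : ℝ) ^ (N - 1) := by nlinarith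
        _ = (N : ℝ) * ((1 - θ) * (2 : ℝ) ^ (N - 1)) := by ring
        _ ≤ (N : ℝ) * (losers β c).card := mul_le_mul_of_nonneg_left hl hNpos.le
    have hlosN : 2 ^ (N - 1) ≤ N * (losers β c).card := by exact_mod_cast hlosR
    calc 2 ^ (N - 1) ≤ N * (losers β c).card := hlosN
      _ ≤ N * (nonExact β c).card := Nat.mul_le_mul_left _ (card_le_card (losers_subset_nonExact β c))
      _ ≤ N ^ (e + 1) * (nonExact β c).card := by
        refine Nat.mul_le_mul_right _ ?_
        calc N = N ^ 1 := (pow_one _).symm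
          _ ≤ N ^ (e + 1) := Nat.pow_le_pow_right (by omega) (by omega)

/-- **(NP₁) ⟸ FIBRE DICHOTOMY + (W) (PROVED glue):** the architecture of ROUND-32. -/
theorem polyLoss_of_wide (hD : FibreDichotomy) (hW : WideNonExact) : AffBellsPolyLoss3 :=
  polyLoss_of_exFib hD (exFib_of_wide hW)


end AffBells33

end Summit.QuantumAdvantage.AdviceFreeQNC0
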